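import Mathlib
import Summits.NavierStokesRegularity.NavierStokesRegularity.Theses.MergerLadder
import HarnessLib

/-!
# `MergerLadder.TargetRefutesNoTypeII` — a two-sided super-Type-I power rate refutes `NoTypeII`
  (route `MergerLadder`, item stmt-NavierStokesRegularity-1057, support; cross-route bookkeeping)

**Statement.** If some maximal smooth Leray–Hopf solution from a rapidly decaying datum has the
two-sided rate `c(T−t)^{−a} ≤ sup‖u(t)‖`, `‖u(t,·)‖ ≤ C(T−t)^{−a}` with `a > 1/2` near `T`, then
`NoTypeII` (every such maximal solution is a Type-I blow-up) fails.

PROOF. `NoTypeII` would give `‖u(t,x)‖ ≤ C'/√(T − t)` eventually as `t ↑ T`; with the lower bound,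
`c ≤ C'(T − t)^{a − 1/2} → 0`, contradicting `c > 0` (~30 lines of real analysis with filters).

HONEST FRAMING: an implication between statements about HYPOTHETICAL blow-ups; nothing here bears
on the regularity problem itself.
-/

noncomputable section

set_option linter.dupNamespace false

namespace Summit.NavierStokesRegularity.NavierStokesRegularity.Theorems

open Set Filter Topology
open Literature.Analysis Literature.Analysis.FluidPDE

/-- **Item stmt-NavierStokesRegularity-1057** (`MergerLadder.TargetRefutesNoTypeII`): a rate
`(T−t)^{−a}`, `a > 1/2`, from below is incompatible with the Type-I rate `(T−t)^{−1/2}`. [this file] -/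
theorem mergerLadder_targetRefutesNoTypeII_proof :
    Summit.NavierStokesRegularity.NavierStokesRegularity.Theses.MergerLadder.TargetRefutesNoTypeII := by
  unfold Summit.NavierStokesRegularity.NavierStokesRegularity.Theses.MergerLadder.TargetRefutesNoTypeII
  rintro ⟨ν, hν, T, hT, u, p, hmax, hLH, hdec, a, c, C, t₁, ha, -, hc, ht₁, ht₁T, hrate⟩ hNT
  obtain ⟨C', hC'⟩ := hNT ν T hν hT u p hmax hLH hdec
  -- `(T − t)^{a − 1/2} → 0` as `t ↑ T`, hence eventually `C' (T−t)^{a−1/2} < c`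
  have hexp : 0 < a - 1 / 2 := by linarith
  have htend : Tendsto (fun t : ℝ => C' * (T - t) ^ (a - 1 / 2)) (𝓝[<] T) (𝓝 0) := by
    have h1 : Tendsto (fun t : ℝ => T - t) (𝓝[<] T) (𝓝 0) := by
      have : Tendsto (fun t : ℝ => T - t) (𝓝 T) (𝓝 (T - T)) :=
        (continuous_const.sub continuous_id).tendsto T
      rw [sub_self] at this
      exact this.mono_left nhdsWithin_le_nhds
    have h2 : Tendsto (fun t : ℝ => (T - t) ^ (a - 1 / 2)) (𝓝[<] T) (𝓝 0) := by
      have := h1.rpow_const (p := a - 1 / 2) (Or.inr hexp.le)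
      rwa [Real.zero_rpow hexp.ne'] at this
    simpa using h2.const_mul C'
  have hsmall : ∀ᶠ t in 𝓝[<] T, C' * (T - t) ^ (a - 1 / 2) < c :=
    htend.eventually (Iio_mem_nhds hc)
  have hwin : ∀ᶠ t in 𝓝[<] T, t ∈ Ico t₁ T :=
    mem_nhdsWithin.2 ⟨Ioi t₁, isOpen_Ioi, ht₁T, fun t ht => ⟨le_of_lt ht.1, ht.2⟩⟩
  obtain ⟨t, ⟨htI, hrt⟩, hst⟩ := ((hwin.and hC').and hsmall).exists
  have hTt : 0 < T - t := sub_pos.2 htI.2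
  obtain ⟨x, hx⟩ := (hrate t htI).2
  have hup := hrt x
  -- `c (T−t)^{−a} ≤ ‖u t x‖ ≤ C'/√(T−t)` ⇒ `c ≤ C' (T−t)^{a−1/2}`
  have hpow : (T - t) ^ (-a) = ((T - t) ^ a)⁻¹ := Real.rpow_neg hTt.le a
  have hsqrt : Real.sqrt (T - t) = (T - t) ^ (1 / 2 : ℝ) := Real.sqrt_eq_rpow _
  have hpa : 0 < (T - t) ^ a := Real.rpow_pos_of_pos hTt a
  have key : c ≤ C' * (T - t) ^ (a - 1 / 2) := by
    have h1 : c * ((T - t) ^ a)⁻¹ ≤ C' / (T - t) ^ (1 / 2 : ℝ) := by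
      rw [← hpow, ← hsqrt]; exact hx.trans hup
    rw [← div_eq_mul_inv, div_le_iff₀ hpa] at h1
    calc c ≤ C' / (T - t) ^ (1 / 2 : ℝ) * (T - t) ^ a := h1
      _ = C' * ((T - t) ^ a / (T - t) ^ (1 / 2 : ℝ)) := by ring
      _ = C' * (T - t) ^ (a - 1 / 2) := by rw [← Real.rpow_sub hTt]
  linarith

end Summit.NavierStokesRegularity.NavierStokesRegularity.Theorems

end
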